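import Summits.CriticalPhenomena.PercolationContinuityZ3.Theorems.SahiCISAtomicDecide
import Summits.CriticalPhenomena.PercolationContinuityZ3.Theorems.SahiCISMonotoneImage
import Summits.CriticalPhenomena.PercolationContinuityZ3.Theorems.SahiCISStrictMono

/-!
# CI is not preserved by coordinatewise (non-injective) increasing maps either

Cell `prim-sahi`, literature seat (generation 31; Theorems/ being prover-only, to be landed by a prover seat);
`--supports stmt-CriticalPhenomena-4575`.  No named facts, no sorries; the combinatorics is a kernel
computation (`decide`) through `SahiCISAtomicDecide.lean`.

Müller–Stoyan, *Comparison Methods for Stochastic Models and Risks* (2002), Def. 3.10.9 c): `X` is *conditionally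
increasing* (CI) if `X_i ↑st X_J` for all `J ⊆ {1,…,n}`, `i ∉ J`; "CI holds if and only if `X_π` is CIS for all
permutations `π`".  Their Thm. 3.10.19 lists CIS and CI among eleven dependence notions preserved by
`X ↦ (f_1(X_1),…,f_n(X_n))` for (weakly) increasing `f_i`.  `SahiCISMonotoneImage.lean` (typer gen 17) refutes the
CIS clause for non-injective `f_i` in dimension `3`; this file refutes the CI clause as well (dimension `3`), with
CI formalised as CIS in the a.e.-kernel sense after every permutation of the coordinates (`IsCIae`):

* `sixAtomLaw` — the law `(4δ_(0,0,0) + δ_(½,0,0) + 2δ_(½,½,0) + δ_(1,0,1) + δ_(1,½,1) + δ_(1,1,1)) / 10` on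
  `[0,1]³` (so `X₂ = 𝟙{X₀ = 1}`);
* `isCISae_sixAtomLaw_map_comp` — for EVERY coordinate map `τ : Fin 3 → Fin 3` (the six permutations and the
  `21` non-injective relabellings) the law of `(X_{τ 0}, X_{τ 1}, X_{τ 2})` is `IsCISae 3`; hence
  **`isCIae_sixAtomLaw`**: the law is CI;
* `map_collapseMap_sixAtomLaw` — its image under the coordinatewise increasing map
  `collapseMap ½ : (x₀,x₁,x₂) ↦ (min(x₀,½), x₁, x₂)` is the law
  `(4δ_(0,0,0) + δ_(½,0,0) + 2δ_(½,½,0) + δ_(½,0,1) + δ_(½,½,1) + δ_(½,1,1)) / 10`, which is NOT CIS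
  (`not_isCISae_sixImageLaw`: given `(Y₀,Y₁) = (½,0) ≤ (½,½)` the conditional laws of `Y₂` are Bernoulli `½`
  and Bernoulli `⅓` — the merged conditioning atoms `(½,x₁) ∪ (1,x₁)` carry mixture weights that are not
  TP₂-ordered in `x₁`);
* **`exists_isCIae_map_monotone_not_isCISae`** / **`exists_isCIae_map_monotone_not_isCIae`** — a CI law on
  `[0,1]³` and a coordinatewise increasing measurable self-map of `[0,1]³` whose image law is not even CIS.

So of the eleven notions in Müller–Stoyan's Thm. 3.10.19 both CIS and CI need injectivity of the `f_i` in
dimension `≥ 3` (for strictly increasing maps: `SahiCISStrictMono.lean`).  The example was first found and checked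
by exact enumeration (cell HOME `code/lit/ms02_thm31019_ci_check.py`, `…_check2.py`, literature seat gen 30);
this file is the kernel check.  References: Müller–Stoyan 2002, Def. 3.10.9, Thm. 3.10.19 [MullerStoyan2002];
Barlow–Proschan 1975, Ch. 5 Def. 4.5–4.6 (CIS) [BarlowProschan1975].  The counterexample is this work.
-/

noncomputable section

namespace Summit.CriticalPhenomena.PercolationContinuityZ3.Theorems.SahiCIS

open MeasureTheory Set Function
open Summit.CriticalPhenomena.PercolationContinuityZ3.Theorems.SahiBoxTP2
open scoped ENNReal unitInterval

/-! ### CI in the a.e.-kernel sense -/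

section CI

variable {d : ℕ}

/-- **CI (conditionally increasing) in the a.e.-kernel sense**: the law of `(X_{τ 0}, …, X_{τ (d-1)})` is CIS
(`IsCISae`) for every permutation `τ` of the coordinates — Müller–Stoyan Def. 3.10.9 c) via "CI holds if and only
if `X_π` is CIS for all permutations `π`". [this work] -/
def IsCIae (d : ℕ) (μ : Measure (Fin d → I)) : Prop :=
  ∀ τ : Equiv.Perm (Fin d), IsCISae d (μ.map fun x : Fin d → I => x ∘ ⇑τ)

/-- CI implies CIS (take the identity permutation). [this work] -/
theorem IsCIae.isCISae {μ : Measure (Fin d → I)} (h : IsCIae d μ) : IsCISae d μ := by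
  have h1 := h 1
  rwa [show (fun x : Fin d → I => x ∘ ⇑(1 : Equiv.Perm (Fin d))) = id from rfl, Measure.map_id] at h1

end CI

/-! ### The six-atom law -/

section Six

/-- The point `½ ∈ [0,1]`. -/
def ptHalf : I := ⟨2⁻¹, by rw [Set.mem_Icc]; norm_num⟩

/-- The code values `0 < ½ < 1` in `[0,1]`. [this work] -/
def codeVal : Fin 3 → I := ![⊥, ptHalf, ⊤]

/-- The code values are strictly increasing. [this work] -/
theorem strictMono_codeVal : StrictMono codeVal := by
  refine Fin.strictMono_iff_lt_succ.2 fun i => ?_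
  fin_cases i
  · change (0 : ℝ) < 2⁻¹; norm_num
  · change (2⁻¹ : ℝ) < 1; norm_num

/-- The codes of the six atoms `(0,0,0), (½,0,0), (½,½,0), (1,0,1), (1,½,1), (1,1,1)`. [this work] -/
def sixCodes : Fin 6 → Fin 3 → Fin 3 := ![![0, 0, 0], ![1, 0, 0], ![1, 1, 0], ![2, 0, 2], ![2, 1, 2], ![2, 2, 2]]

/-- The codes of the six image atoms `(0,0,0), (½,0,0), (½,½,0), (½,0,1), (½,½,1), (½,1,1)`. [this work] -/
def sixImageCodes : Fin 6 → Fin 3 → Fin 3 :=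
  ![![0, 0, 0], ![1, 0, 0], ![1, 1, 0], ![1, 0, 2], ![1, 1, 2], ![1, 2, 2]]

/-- The weights `4, 1, 2, 1, 1, 1` (total `10`). [this work] -/
def sixWeights : Fin 6 → ℕ := ![4, 1, 2, 1, 1, 1]

/-- The total weight is `10`. [this work] -/
theorem sum_sixWeights : (∑ k, sixWeights k) = 10 := by decide

/-- Normalised coded laws with the six weights are probability measures (any codes). [this work] -/
instance isProbabilityMeasure_smul_codedLaw_six {d : ℕ} (c : Fin 6 → Fin d → Fin 3) :
    IsProbabilityMeasure ((10 : ℝ≥0∞)⁻¹ • codedLaw codeVal c sixWeights) :=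
  ⟨by
    rw [Measure.smul_apply, smul_eq_mul, codedLaw_univ, sum_sixWeights]
    exact ENNReal.inv_mul_cancel (by norm_num) (by norm_num)⟩

/-- **The six-atom law** `(4δ_(0,0,0) + δ_(½,0,0) + 2δ_(½,½,0) + δ_(1,0,1) + δ_(1,½,1) + δ_(1,1,1)) / 10`
on `[0,1]³`. [this work] -/
def sixAtomLaw : Measure (Fin 3 → I) := (10 : ℝ≥0∞)⁻¹ • codedLaw codeVal sixCodes sixWeights

/-- **The image law** `(4δ_(0,0,0) + δ_(½,0,0) + 2δ_(½,½,0) + δ_(½,0,1) + δ_(½,½,1) + δ_(½,1,1)) / 10`.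
[this work] -/
def sixImageLaw : Measure (Fin 3 → I) := (10 : ℝ≥0∞)⁻¹ • codedLaw codeVal sixImageCodes sixWeights

/-- The six-atom law is a probability measure. [this work] -/
instance isProbabilityMeasure_sixAtomLaw : IsProbabilityMeasure sixAtomLaw :=
  isProbabilityMeasure_smul_codedLaw_six _

/-- The image law is a probability measure. [this work] -/
instance isProbabilityMeasure_sixImageLaw : IsProbabilityMeasure sixImageLaw :=
  isProbabilityMeasure_smul_codedLaw_six _

/-- **Kernel computation**: the atom condition holds at every level for the six-atom codes relabelled by ANY
coordinate map `τ : Fin 3 → Fin 3` (27 maps × 3 levels). [this work] -/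
theorem cisCheckAll_sixCodes_comp :
    ∀ τ : Fin 3 → Fin 3, cisCheckAll 3 (fun k => sixCodes k ∘ τ) sixWeights = true := by
  decide +kernel

/-- **Kernel computation**: the atom condition FAILS for the image codes (level `3`: prefixes `(1,0) ≤ (1,1)`,
threshold `0`: `2 · 2 > 1 · 3`). [this work] -/
theorem cisCheckAll_sixImageCodes : cisCheckAll 3 sixImageCodes sixWeights = false := by decide

/-- For every coordinate map `τ`, the law of `(X_{τ 0}, X_{τ 1}, X_{τ 2})` under the six-atom law is CIS in the
a.e.-kernel sense. [this work] -/
theorem isCISae_sixAtomLaw_map_comp (τ : Fin 3 → Fin 3) :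
    IsCISae 3 (sixAtomLaw.map fun x : Fin 3 → I => x ∘ τ) := by
  rw [sixAtomLaw, Measure.map_smul, codedLaw_map_comp]
  exact (isCISae_smul_codedLaw_iff strictMono_codeVal _ _ (by norm_num) (by norm_num)).2
    (cisCheckAll_sixCodes_comp τ)

/-- **The six-atom law is CI.** [this work] -/
theorem isCIae_sixAtomLaw : IsCIae 3 sixAtomLaw := fun τ => isCISae_sixAtomLaw_map_comp ⇑τ

/-- The six-atom law is CIS. [this work] -/
theorem isCISae_sixAtomLaw : IsCISae 3 sixAtomLaw := isCIae_sixAtomLaw.isCISae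

/-- **The image law is not CIS** (a fortiori not CI). [this work] -/
theorem not_isCISae_sixImageLaw : ¬ IsCISae 3 sixImageLaw := by
  rw [sixImageLaw, isCISae_smul_codedLaw_iff strictMono_codeVal _ _ (by norm_num) (by norm_num),
    cisCheckAll_sixImageCodes]
  decide

/-- The image law is not CI. [this work] -/
theorem not_isCIae_sixImageLaw : ¬ IsCIae 3 sixImageLaw := fun h => not_isCISae_sixImageLaw h.isCISae

end Six

/-! ### The collapse -/

section Collapse

/-- `collapseMap ½` on coded points collapses the first code to `min(·, 1)`. [this work] -/
theorem collapseMap_codeVal_comp (u : Fin 3 → Fin 3) :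
    collapseMap ptHalf (codeVal ∘ u) = codeVal ∘ ![min (u 0) 1, u 1, u 2] := by
  funext i
  refine Fin.cases ?_ (fun j => ?_) i
  · show min (codeVal (u 0)) (codeVal 1) = codeVal (min (u 0) 1)
    exact (strictMono_codeVal.monotone.map_min).symm
  · refine Fin.cases rfl (fun k => ?_) j
    exact Fin.cases rfl (fun l => l.elim0) k

/-- The collapsed codes of the six atoms are the image codes. [this work] -/
theorem collapse_sixCodes (k : Fin 6) : ![min (sixCodes k 0) 1, sixCodes k 1, sixCodes k 2] = sixImageCodes k := by
  fin_cases k <;> decide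

/-- **The image of the six-atom law under `collapseMap ½` is the image law.** [this work] -/
theorem map_collapseMap_sixAtomLaw : sixAtomLaw.map (collapseMap ptHalf) = sixImageLaw := by
  rw [sixAtomLaw, sixImageLaw, Measure.map_smul, codedLaw, atomicLaw_map _ _ (measurable_collapseMap _), codedLaw]
  congr 2
  funext k
  show collapseMap ptHalf (codeVal ∘ sixCodes k) = codeVal ∘ sixImageCodes k
  rw [collapseMap_codeVal_comp, collapse_sixCodes]

end Collapse

/-! ### The theorem -/

section Main

/-- **CI is not preserved by coordinatewise increasing maps** (dimension `3`): the six-atom law is CI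
(`IsCIae 3`), `collapseMap ½` is coordinatewise increasing and measurable, and the image law is not even CIS.
(Müller–Stoyan Thm. 3.10.19 for CI, like for CIS, needs strictly increasing maps.) [this work] -/
theorem exists_isCIae_map_monotone_not_isCISae :
    ∃ (μ : Measure (Fin 3 → I)) (Φ : (Fin 3 → I) → Fin 3 → I), IsProbabilityMeasure μ ∧ IsCIae 3 μ ∧
      Monotone Φ ∧ Measurable Φ ∧ ¬ IsCISae 3 (μ.map Φ) :=
  ⟨sixAtomLaw, collapseMap ptHalf, inferInstance, isCIae_sixAtomLaw, monotone_collapseMap _,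
    measurable_collapseMap _, by rw [map_collapseMap_sixAtomLaw]; exact not_isCISae_sixImageLaw⟩

/-- **CI is not preserved by coordinatewise increasing maps** (dimension `3`), CI-to-CI form. [this work] -/
theorem exists_isCIae_map_monotone_not_isCIae :
    ∃ (μ : Measure (Fin 3 → I)) (Φ : (Fin 3 → I) → Fin 3 → I), IsProbabilityMeasure μ ∧ IsCIae 3 μ ∧
      Monotone Φ ∧ Measurable Φ ∧ ¬ IsCIae 3 (μ.map Φ) :=
  ⟨sixAtomLaw, collapseMap ptHalf, inferInstance, isCIae_sixAtomLaw, monotone_collapseMap _,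
    measurable_collapseMap _, by rw [map_collapseMap_sixAtomLaw]; exact not_isCIae_sixImageLaw⟩

end Main

/-! ### The positive half: strictly increasing maps (appended)

Appended (append protocol; all earlier declarations unchanged): the CI analogue of `IsCISae.map_coordMap`
(`SahiCISStrictMono.lean`), authored by the `prim-sahi` literature seat (generation 31, file v2) and landed by a
prover seat.  Together with `exists_isCIae_map_monotone_not_isCIae` this types the corrected CI clause of
Müller–Stoyan Thm. 3.10.19: it fails for non-injective increasing `f_i` (dimension `3`) and holds for strictly
increasing `f_i` (every dimension). -/

section StrictMonoCI

variable {d : ℕ}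

/-- **CI in the a.e.-kernel sense IS preserved by coordinatewise strictly increasing maps** (every dimension):
relabelling the coordinates commutes with coordinatewise maps
(`(fun x => x ∘ ⇑τ) ∘ coordMap φ = coordMap (φ ∘ τ) ∘ (fun x => x ∘ ⇑τ)`, by `rfl`), and CIS is preserved by
coordinatewise strictly increasing maps (`IsCISae.map_coordMap`). [this work] -/
theorem IsCIae.map_coordMap {μ : Measure (Fin d → I)} [IsProbabilityMeasure μ] (φ : Fin d → I → I)
    (hφ : ∀ i, StrictMono (φ i)) (h : IsCIae d μ) : IsCIae d (μ.map (coordMap φ)) := by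
  intro τ
  have hτ : Measurable fun x : Fin d → I => x ∘ ⇑τ := measurable_pi_lambda _ fun i => measurable_pi_apply _
  have hc : Measurable (coordMap φ) := measurable_coordMap fun i => (hφ i).monotone.measurable
  have hc' : Measurable (coordMap fun i => φ (τ i)) := measurable_coordMap fun i => (hφ (τ i)).monotone.measurable
  rw [Measure.map_map hτ hc, show (fun x : Fin d → I => x ∘ ⇑τ) ∘ coordMap φ =
    coordMap (fun i => φ (τ i)) ∘ fun x : Fin d → I => x ∘ ⇑τ from rfl, ← Measure.map_map hc' hτ]
  haveI : IsProbabilityMeasure (μ.map fun x : Fin d → I => x ∘ ⇑τ) :=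
    Measure.isProbabilityMeasure_map hτ.aemeasurable
  exact IsCISae.map_coordMap d _ _ (fun i => hφ (τ i)) (h τ)

end StrictMonoCI

end Summit.CriticalPhenomena.PercolationContinuityZ3.Theorems.SahiCIS

end
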